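import Literature.MathematicalPhysics.QuantumFieldTheory.Balaban1983to89.B9SectionCarryingMembersV1
import Literature.MathematicalPhysics.QuantumFieldTheory.Balaban1983to89.B9BetaNotchMemberV1
import Literature.MathematicalPhysics.QuantumFieldTheory.Balaban1983to89.B9BetaOntoOfBoxLevels
import HarnessLib

/-!
# Sections of the carrier-block map `β` over NODE 00's member type `MemberY` — a neutral dictionary note

statement-level skeleton of published theorems with citation tags; proofs where landed; nothing here is a claim about the Yang–Mills mass gap
(cell `pub-ymgap`, unit `pub-ymgap-node00-def-Y` g36, the custodian of NODE 00's member dictionary; director-ym №524 (2) GO, dag-n06-d «yes»).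

WHAT IS HERE (bookkeeping over LANDED constructions; NO new root field, NO edit of `B9PinMembersKLevelV1.MemberY`):
* `Node00.HasSectionsY x` — the member `x : MemberY …` CARRIES SECTIONS: its carrier-block map `β : IBondY x → BlkY x` ([4] (2.3)/(2.45), «sites replaced by
  bonds» p.248) is onto `𝔅`; equivalently a right inverse `ιB` with `β ∘ ιB = id` exists (`hasSectionsY_iff_exists_section`) — the displayed pair `(ιB, hι)` of
  the faces instantiated at a member.
* `SCMemberY_eq` (`rfl`): dag-n06-c's section-carrying sub-family `B9SectionCarryingMembersV1.SCMemberY` IS `{x : MemberY … // HasSectionsY x}`; nothing to add.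
* THE DICHOTOMY OF RECORD, by name: (i) members all of whose levels `Ω_{j+1}` are coordinate boxes carry sections (`hasSectionsY_of_levBoxes` ← dag-n06-j's
  `B9BetaOntoOfBoxLevels.surjective_beta_of_levBoxes`), and section-carrying members exist beyond every threshold (`B9SectionCarryingMembersV1.exists_scMember_ge`);
  (ii) members WITH AN INNER CORNER do not: the notch member of dag-n06-c's `B9BetaNotchMemberV1` (`exists_member_not_hasSectionsY` ←
  `exists_member_not_surjective_beta`), hence `not_forall_hasSectionsY` and no family of sections over ALL members (`B9BetaNotchMemberV1.not_exists_sections_memberY`);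
  the characterisation «onto iff no inner corner» is dag-n06-i's `B9BetaRangeKLevelV1.surjective_beta_iff` (`hasSectionsY_iff_noInnerCorner`).

LABEL OF RECORD (director-ym №524 (1)–(2), def-Y's correction upheld): [Balaban1985Averaging] p.18 (4) constrains the ONE region `Ω` (a union of `k`-blocks), NOT the
re-entrant corners of the nested family `Ω_k ⊂ … ⊂ Ω_1` of [4] (2.1)–(2.4); the notch family satisfies (2.1)/(2.2) and is a legitimate member, so `Surjective β` is
NOT a printed hypothesis and is NOT added at the root.  Statements our proofs can only reach through sections are instantiated at `SCMemberY` and DISPLAYED at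
members with an inner corner with the label «print's (2.1)–(2.4)∕(4) do not exclude them; whether [B9] Thm 3.3∕3.11∕(3.48) hold there is OPEN in the tree (our proofs
need sections)» — never «outside print's family».  HONEST: dictionary only; nothing of [4]/[B9] asserted; N06 NOT discharged; count-neutral; no `instance`,
no notation, no `sorry`.
-/

noncomputable section

namespace Literature.MathematicalPhysics.QuantumFieldTheory.Balaban1983to89.Node00

open B6MultiLevelBoxOperator (N0)
open B6GlobalChartV1 (PV toBox)
open B6Ineq2142KLevelV1 (β)
open B9PinMembersKLevelV1 (MemberY geo9Y)
open B9SectionCarryingMembersV1 (SCMemberY)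

variable {d ℓ : ℕ} {hd : 1 ≤ d + 1} {hL : Odd (ℓ + 1) ∧ 1 < ℓ + 1} {b₀ b₁ : ℝ} {Mstar : ℕ}

/-- ★ **THE MEMBER CARRIES SECTIONS**: its carrier-block map `β : IBondY x → BlkY x` is onto `𝔅` (no inner corner).
[cite: Balaban1984PropagatorsII, (2.3) p.224, (2.45) p.231, p.248 («sites replaced by bonds»)] -/
def HasSectionsY (x : MemberY d ℓ hd hL b₀ b₁ Mstar) : Prop := Function.Surjective (β x.toKIdx.hN x.toKIdx.D x.toKIdx.hk)

/-- Unfolding of `HasSectionsY`. [cite: Balaban1984PropagatorsII, (2.3) p.224 (bookkeeping)] -/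
theorem hasSectionsY_iff (x : MemberY d ℓ hd hL b₀ b₁ Mstar) : HasSectionsY x ↔ Function.Surjective (β x.toKIdx.hN x.toKIdx.D x.toKIdx.hk) := Iff.rfl

/-- ★ SECTIONS EXIST IFF `β` IS ONTO: `HasSectionsY x ↔ ∃ ιB : BlkY x → IBondY x, ∀ s, β (ιB s) = s` — the displayed pair `(ιB, hι)` of a face read at the member `x`.
[cite: Balaban1984PropagatorsII, (2.3) p.224, (2.45) p.231] -/
theorem hasSectionsY_iff_exists_section (x : MemberY d ℓ hd hL b₀ b₁ Mstar) :
    HasSectionsY x ↔ ∃ ιB : BlkY x.toKIdx → IBondY x.toKIdx, ∀ s, β x.toKIdx.hN x.toKIdx.D x.toKIdx.hk (ιB s) = s :=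
  Function.surjective_iff_hasRightInverse

/-- A section of a section-carrying member, by choice (`= SCMemberY.ιBsc ⟨x, h⟩`). [cite: Balaban1984PropagatorsII, (2.3) p.224, (2.45) p.231] -/
def HasSectionsY.section {x : MemberY d ℓ hd hL b₀ b₁ Mstar} (h : HasSectionsY x) : BlkY x.toKIdx → IBondY x.toKIdx := Function.surjInv h

/-- `β (h.section s) = s`. [cite: Balaban1984PropagatorsII, (2.3) p.224, (2.45) p.231] -/
theorem HasSectionsY.beta_section {x : MemberY d ℓ hd hL b₀ b₁ Mstar} (h : HasSectionsY x) (s : BlkY x.toKIdx) :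
    β x.toKIdx.hN x.toKIdx.D x.toKIdx.hk (h.section s) = s :=
  Function.surjInv_eq h s

/-- ★ `SCMemberY = {x : MemberY … // HasSectionsY x}` — dag-n06-c's section-carrying sub-family IS the subtype cut out by `HasSectionsY`, by `rfl`.
[cite: Balaban1984PropagatorsII, (2.3) p.224, (2.45) p.231 (bookkeeping)] -/
theorem SCMemberY_eq : SCMemberY d ℓ hd hL b₀ b₁ Mstar = {x : MemberY d ℓ hd hL b₀ b₁ Mstar // HasSectionsY x} := rfl

/-- every `j : SCMemberY` carries sections. [cite: Balaban1984PropagatorsII, (2.3) p.224, (2.45) p.231 (bookkeeping)] -/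
theorem SCMemberY.hasSectionsY (j : SCMemberY d ℓ hd hL b₀ b₁ Mstar) : HasSectionsY j.val := j.2

/-! ## The dichotomy of record, by name -/

/-- ★ (i) **BOX-LEVEL MEMBERS CARRY SECTIONS** (dag-n06-j's `B9BetaOntoOfBoxLevels.surjective_beta_of_levBoxes`, read at a member): if `d + 1 ≥ 2` and every
`Ω_{j+1}`, `1 ≤ j < k`, is a coordinate box of fine sites, then `β` is onto (`1 ≤ k` from the member's `2 ≤ k`). [cite: Balaban1984PropagatorsII, (2.3) p.224, (2.45) p.231; Balaban1989LargeFieldI, p.177] -/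
theorem hasSectionsY_of_levBoxes (x : MemberY d ℓ hd hL b₀ b₁ Mstar) (hd1 : 1 ≤ d)
    (hbox : ∀ j, 1 ≤ j → j < x.k → ∃ J : ∀ ν : Fin (d + 1), Set (ZMod ((PV d ℓ x.m x.K hd hL).sitesPerDir 0)),
      ∀ y : Site (PV d ℓ x.m x.K hd hL) 0, j + 1 ≤ x.D.lev (toBox x.hN y : Fin (d + 1) → ℤ) ↔ ∀ ν, y ν ∈ J ν) :
    HasSectionsY x :=
  B9BetaOntoOfBoxLevels.surjective_beta_of_levBoxes x.toKIdx.hN x.toKIdx.D x.toKIdx.hk hd1 (le_trans (by norm_num) x.hk2) hbox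

/-- (i′) section-carrying members exist beyond every `M`-threshold, at every `M⋆` (odd `L ≥ 5`, `0 < b₀ ≤ b₁`; dag-n06-c's `exists_scMember_ge`).
[cite: Balaban1984PropagatorsII, (2.1)–(2.4) p.224, (2.45) p.231] -/
theorem exists_member_hasSectionsY (hℓ : 4 ≤ ℓ) (M₁ : ℝ) (hb₀ : 0 < b₀) (hb₁ : b₀ ≤ b₁) :
    ∃ x : MemberY d ℓ hd hL b₀ b₁ Mstar, M₁ ≤ (geo9Y x).M ∧ HasSectionsY x :=
  B9SectionCarryingMembersV1.exists_member_surjective_beta (d := d) (hd := hd) (hL := hL) hℓ Mstar M₁ hb₀ hb₁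

/-- ★ (ii) **MEMBERS WITH AN INNER CORNER DO NOT CARRY SECTIONS, AND THEY EXIST BEYOND EVERY THRESHOLD** (dag-n06-c's notch member,
`B9BetaNotchMemberV1.exists_member_not_surjective_beta`). [cite: Balaban1984PropagatorsII, (2.1)–(2.4) p.224, (2.45) p.231, p.248] -/
theorem exists_member_not_hasSectionsY (hℓ : 4 ≤ ℓ) (M₁ : ℝ) (hb₀ : 0 < b₀) (hb₁ : b₀ ≤ b₁) :
    ∃ x : MemberY d ℓ hd hL b₀ b₁ Mstar, M₁ ≤ (geo9Y x).M ∧ ¬ HasSectionsY x :=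
  B9BetaNotchMemberV1.exists_member_not_surjective_beta d ℓ hd hL hℓ Mstar M₁ hb₀ hb₁

/-- ★ hence **NOT EVERY MEMBER CARRIES SECTIONS** (odd `L ≥ 5`, `0 < b₀ ≤ b₁`, every `M⋆`): `Surjective β` is a property of a SUB-family, not of print's family.
[cite: Balaban1984PropagatorsII, (2.1)–(2.4) p.224, (2.45) p.231, p.248] -/
theorem not_forall_hasSectionsY (hℓ : 4 ≤ ℓ) (hb₀ : 0 < b₀) (hb₁ : b₀ ≤ b₁) :
    ¬ ∀ x : MemberY d ℓ hd hL b₀ b₁ Mstar, HasSectionsY x := by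
  obtain ⟨x, -, hx⟩ := exists_member_not_hasSectionsY (d := d) (hd := hd) (hL := hL) (Mstar := Mstar) hℓ 0 hb₀ hb₁
  exact fun h => hx (h x)

/-- ★ **THE CHARACTERISATION**: a member carries sections iff its family has NO INNER CORNER (dag-n06-i's `B9BetaRangeKLevelV1.surjective_beta_iff`, read at
the member; `1 ≤ k` holds since `2 ≤ k`). [cite: Balaban1984PropagatorsII, (2.3) p.224, (2.45) p.231, p.248] -/
theorem hasSectionsY_iff_noInnerCorner (x : MemberY d ℓ hd hL b₀ b₁ Mstar) :
    HasSectionsY x ↔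
      ∀ y : Site (PV d ℓ x.m x.K hd hL) 0,
        (∃ μ, ¬ (B6GlobalChartV1.domT x.hN x.D x.hk).Deep (x.D.lev (toBox x.hN y : Fin (d + 1) → ℤ))
            ((B5Eq118OneStroke.iterBlockOf (x.D.lev (toBox x.hN y : Fin (d + 1) → ℤ)) y).shift μ)) ∨
          (∃ μ, (B5Eq118OneStroke.iterBlockOf (x.D.lev (toBox x.hN y : Fin (d + 1) → ℤ)) y).unshift μ ∉
            (B6GlobalChartV1.domT x.hN x.D x.hk).Om (x.D.lev (toBox x.hN y : Fin (d + 1) → ℤ))) :=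
  B9BetaRangeKLevelV1.surjective_beta_iff x.toKIdx.hN x.toKIdx.D x.toKIdx.hk (le_trans (by norm_num) x.hk2)

end Literature.MathematicalPhysics.QuantumFieldTheory.Balaban1983to89.Node00

end
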